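import Mathlib
import Summits.Ventures.PercRepro2.CoinLsmHead
import Summits.Ventures.PercRepro2.CoinForestLaw

/-!
# Row 2′DARC at every head whose routes form a pendant FOREST (blind cell PercRepro2,
night-2 g5; proofs/NIGHT2-DARC.md §27)

THEOREM `darc_of_forestHead_mixed`: `P = {w} ∪ Vs`, where `Vs` is a pendant forest below `t`
(every `v ∈ Vs` has the single out-coin `d v = {v → par v}`, `par v ∈ Vs ∪ {t}`, a rank decreasing
along `par`), `w` has the single-arc arm coins `c v = {w → v}` into a subset `A ⊆ Vs` of the
forest (any probabilities), and the coins `c v` (`v ∈ A`), `d v` (`v ∈ Vs`) are the ONLY coins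
with tails in `P` (`OnlyForestCoins`); entries from the core into `P ∪ {t}`
arbitrary, the rest of the system arbitrary (`SameEnds`); `a, b, u ∉ P ∪ {t}`; the reduced
avoidance events non-degenerate.  Then `DARC p arcs s {t} a b u w` — any number of routes from
`w` to `t`, of any lengths, sharing vertices in a tree-like way.  The k-stars, the pathstar and the
two chains of length 2 are the cases `par ≡ t`, `par = (v₁ ↦ v₂, v₂ ↦ t, v₃ ↦ t)` and
`(v₁ ↦ v₂, v₂ ↦ t, v₃ ↦ v₄, v₄ ↦ t)`.  Proof: `darc_of_lsmHead_mixed` with the log-supermodularity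
of the forest trace law `forest_trace_lsm`.
-/

namespace Summit.Ventures.PercRepro2.Coin

section ForestHead

variable {V : Type*} {E : Type*} [DecidableEq V]

/-- The arm and forest coins are the only coins carrying an arc with tail in `{w} ∪ Vs`. -/
def OnlyForestCoins (arcs : E → Finset (V × V)) (w : V) (A Vs : Finset V) (c d : V → E) :
    Prop :=
  ∀ e, (∃ xy ∈ arcs e, xy.1 = w ∨ xy.1 ∈ Vs) → (∃ v ∈ A, e = c v) ∨ (∃ v ∈ Vs, e = d v)

variable {arcs : E → Finset (V × V)} {w t : V} {A Vs : Finset V} {c d : V → E} {par : V → V}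

omit [DecidableEq V] in
/-- An arc with tail in the head is an arm arc or a forest arc. -/
lemma forest_arc (hc : ∀ v ∈ A, arcs (c v) = {(w, v)})
    (hd : ∀ v ∈ Vs, arcs (d v) = {(v, par v)}) (honly : OnlyForestCoins arcs w A Vs c d) {e : E}
    {x y : V} (hxy : (x, y) ∈ arcs e) (hx : x = w ∨ x ∈ Vs) :
    (∃ v ∈ A, e = c v ∧ x = w ∧ y = v) ∨ (∃ v ∈ Vs, e = d v ∧ x = v ∧ y = par v) := by
  rcases honly e ⟨(x, y), hxy, hx⟩ with ⟨v, hv, rfl⟩ | ⟨v, hv, rfl⟩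
  · rw [hc v hv, Finset.mem_singleton, Prod.mk.injEq] at hxy
    exact Or.inl ⟨v, hv, rfl, hxy.1, hxy.2⟩
  · rw [hd v hv, Finset.mem_singleton, Prod.mk.injEq] at hxy
    exact Or.inr ⟨v, hv, rfl, hxy.1, hxy.2⟩

/-- The head is closed out into `{t}`. -/
lemma forest_closedOut (hAV : A ⊆ Vs) (hc : ∀ v ∈ A, arcs (c v) = {(w, v)})
    (hd : ∀ v ∈ Vs, arcs (d v) = {(v, par v)}) (hpar : ∀ v ∈ Vs, par v ∈ Vs ∨ par v = t)
    (honly : OnlyForestCoins arcs w A Vs c d) : ClosedOut arcs (insert w Vs) {t} := by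
  intro e xy hxy hx
  simp only [Finset.mem_insert] at hx
  rcases forest_arc hc hd honly hxy hx with ⟨v, hv, _, _, hy⟩ | ⟨v, hv, _, _, hy⟩
  · exact Finset.mem_union_left _ (hy ▸ Finset.mem_insert_of_mem (hAV hv))
  · rcases hpar v hv with h | h
    · exact Finset.mem_union_left _ (hy ▸ Finset.mem_insert_of_mem h)
    · exact Finset.mem_union_right _ (hy ▸ h ▸ Finset.mem_singleton_self t)

/-- The head coins carry only arcs with tails in the head. -/
lemma forest_tailCoinsIn (hc : ∀ v ∈ A, arcs (c v) = {(w, v)})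
    (hd : ∀ v ∈ Vs, arcs (d v) = {(v, par v)}) (honly : OnlyForestCoins arcs w A Vs c d) :
    TailCoinsIn arcs (insert w Vs) {t} := by
  intro e he xy hxy
  obtain ⟨x'y', hx'y', hx'⟩ := he
  simp only [Finset.mem_insert] at hx'
  rcases forest_arc hc hd honly hx'y' hx' with ⟨v, hv, rfl, _, _⟩ | ⟨v, hv, rfl, _, _⟩
  · rw [hc v hv, Finset.mem_singleton] at hxy; subst hxy
    exact Finset.mem_union_left _ (Finset.mem_insert_self w Vs)
  · rw [hd v hv, Finset.mem_singleton] at hxy; subst hxy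
    exact Finset.mem_union_left _ (Finset.mem_insert_of_mem hv)

omit [DecidableEq V] in
/-- Every out-coin of `w` is an arm. -/
lemma forest_onlyw (hwV : w ∉ Vs) (hc : ∀ v ∈ A, arcs (c v) = {(w, v)})
    (hd : ∀ v ∈ Vs, arcs (d v) = {(v, par v)}) (honly : OnlyForestCoins arcs w A Vs c d) :
    ∀ e, (∃ xy ∈ arcs e, xy.1 = w) → ∃ v ∈ A, e = c v := by
  rintro e ⟨⟨x, y⟩, hxy, hx⟩
  rcases forest_arc hc hd honly hxy (Or.inl hx) with ⟨v, hv, rfl, _, _⟩ | ⟨v, hv, _, hx', _⟩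
  · exact ⟨v, hv, rfl⟩
  · exact absurd (hx ▸ hx' ▸ hv) hwV

omit [DecidableEq V] in
/-- No arc of the forest returns to `w`. -/
lemma forest_noback (hwV : w ∉ Vs) (hwt : w ≠ t) (hc : ∀ v ∈ A, arcs (c v) = {(w, v)})
    (hd : ∀ v ∈ Vs, arcs (d v) = {(v, par v)}) (hpar : ∀ v ∈ Vs, par v ∈ Vs ∨ par v = t)
    (honly : OnlyForestCoins arcs w A Vs c d) :
    ∀ e, ∀ xy ∈ arcs e, xy.1 ∈ Vs → xy.2 ≠ w := by
  rintro e ⟨x, y⟩ hxy hx hy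
  rcases forest_arc hc hd honly hxy (Or.inr hx) with ⟨v, _, _, hx', _⟩ | ⟨v, hv, _, _, hy'⟩
  · exact hwV (hx' ▸ hx)
  · rcases hpar v hv with h | h
    · exact hwV (hy ▸ hy' ▸ h)
    · exact hwt (hy ▸ hy' ▸ h)

omit [DecidableEq V] in
/-- The forest coins are the only coins with tails in the forest. -/
lemma forest_onlyForest (hwV : w ∉ Vs) (hc : ∀ v ∈ A, arcs (c v) = {(w, v)})
    (hd : ∀ v ∈ Vs, arcs (d v) = {(v, par v)}) (honly : OnlyForestCoins arcs w A Vs c d) :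
    ∀ e, (∃ xy ∈ arcs e, xy.1 ∈ Vs) → ∃ v ∈ Vs, e = d v := by
  rintro e ⟨⟨x, y⟩, hxy, hx⟩
  rcases forest_arc hc hd honly hxy (Or.inr hx) with ⟨v, _, _, hx', _⟩ | ⟨v, hv, rfl, _, _⟩
  · exact absurd (hx' ▸ hx) hwV
  · exact ⟨v, hv, rfl⟩

end ForestHead

section Theorem

open Classical

variable {V : Type*} {E : Type*} [Fintype V] [DecidableEq V] [Fintype E] [DecidableEq E]
  {R : Type*} [Field R] [LinearOrder R] [IsStrictOrderedRing R]

/-- **THEOREM (row 2′DARC at every head whose routes form a pendant forest).** -/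
theorem darc_of_forestHead_mixed (p : E → R) (hp : IsProbVec p) {arcs : E → Finset (V × V)}
    (hS : SameEnds arcs) (s a b u w t : V) (Vs : Finset V) (hwV : w ∉ Vs) (htV : t ∉ Vs)
    (hwt : w ≠ t) (A : Finset V) (hAV : A ⊆ Vs) {c d : V → E} {par : V → V}
    (hc : ∀ v ∈ A, arcs (c v) = {(w, v)})
    (hd : ∀ v ∈ Vs, arcs (d v) = {(v, par v)}) (hpar : ∀ v ∈ Vs, par v ∈ Vs ∨ par v = t)
    (honly : OnlyForestCoins arcs w A Vs c d) {rk : V → ℕ}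
    (hrk : ∀ v ∈ Vs, par v ∈ Vs → rk (par v) < rk v)
    (ha : a ∉ insert w Vs ∪ {t}) (hb : b ∉ insert w Vs ∪ {t}) (hu : u ∉ insert w Vs ∪ {t})
    (hP : ∀ Z ∈ (insert w Vs).powerset,
      0 < prob p (avoidEvent (arcsOff arcs (insert w Vs ∪ {t})) s (Z ∪ {t})))
    (hQ : ∀ Z ∈ (insert w Vs).powerset,
      0 < prob p (avoidEvent (arcsOff arcs (insert w Vs ∪ {t})) s (gateTarget u w Z {t}))) :
    DARC p arcs s {t} a b u w :=
  darc_of_lsmHead_mixed p hp hS s a b u w t Vs hwV hwt (forest_closedOut hAV hc hd hpar honly)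
    (forest_tailCoinsIn hc hd honly) A hAV hc (forest_onlyw hwV hc hd honly)
    (forest_noback hwV hwt hc hd hpar honly)
    (forest_trace_lsm p hp htV hd hpar (forest_onlyForest hwV hc hd honly) hrk) ha hb hu hP hQ

end Theorem

end Summit.Ventures.PercRepro2.Coin
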